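import Literature.MathematicalPhysics.QuantumFieldTheory.Balaban1983to89.B6Ineq2142KLevelV1
import HarnessLib

/-!
# `Balaban1983to89.B6BlockRunsKLevelV1` — T. Bałaban, *Propagators and renormalization transformations for lattice gauge theories. II*,
Commun. Math. Phys. **96** (1984) 223–250 [Balaban1984PropagatorsII], (2.45)–(2.46) p. 231, (2.2) p. 224: **STRAIGHT RUNS OF FINE SITES NEAR A BLOCK OF `𝔅`
ON THE GENUINE k-LEVEL V1 TORUS FAMILY** — blocks at torus distance `d_T < R·L·M_h − 1` lie on adjacent levels, and a straight run of `≤ a₀L^n` fine steps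
one END of which lies within `d_T ≤ B` of a block `y` stays on levels `≥ n` and moves the block by `≤ a₀ + 2` (file F3a of the interior-energy route to
Prop. 2.6 (2.140)₄ at k levels; cell pub-ymgap, seat dag-p1, `HOME/pub-ymgap-dag-p1/HL3-PLAN.md`; lit-balaban GAPS G-B6-2140-456).
HONEST FRAMING (programme rule): statement-level skeleton of published theorems with citation tags; proofs where landed; nothing here is a claim about
the Yang–Mills mass gap.  Lattice geometry on the torus family of seats p21/p22/r03 (their `distT_run_le`, `crossings_le`, `levelGapT` BY NAME); no
estimate of print is asserted; THEOREMS ONLY; nothing continuum ∕ mass-gap ∕ Clay.  §1 `level_window_of_dist_lt`, `level_ge_of_dist_lt`, `lev_toBox_eq`;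
§2 `run_of_start`, `run_of_end`.  Seat `pub-ymgap-dag-p1` (prover), 2026-08-25.  NOT summit progress.
-/

open scoped BigOperators

namespace Literature.MathematicalPhysics.QuantumFieldTheory.Balaban1983to89.B6BlockRunsKLevelV1

open LatticeFieldCalculus
open B4Reflection242 (boxDom)
open B4TorusKernel.MultiPeriod (torusSupNorm torusSupNorm_nonneg circAbs)
open B6MultiLevelBoxOperator (N0)
open B6MultiLevelTorusOperator (TDomains tshift unitVec)
open B6CubeCoeffSizesV1 (torusSupNorm_tshift_unitVec_le)
open B6Geom246MultiLevelBox (bset blkOf lev_eq_of_blkOf_eq exists_blkOf_eq scale_bounds)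
open B6Geom246MultiLevelTorus (geomT bondT connectedT levelGapT torusSupNorm_neg)
open B6Geometry (levelGap_dist_real)
open B6GlobalChartV1 (PV domT blkV1 toBox toBox_apply)
open B6ScalarChartV1 (toBox_shift)
open B6MemberOfCubeV1 (torusSupNorm_sub_le one_le_N0)
open B6Ineq2142KLevelV1 (distT_run_le crossings crossings_le distT_shift_le_one)
open B5Eq118OneStroke (runSite_add)

noncomputable section

variable {d ℓ m K : ℕ} {hd : 1 ≤ d + 1} {hL : Odd (ℓ + 1) ∧ 1 < ℓ + 1} {Mh k R : ℕ} {P' : Fin (d + 1) → ℕ}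
variable (hN : ∀ μ, N0 ℓ Mh k P' μ = (PV d ℓ m K hd hL).sitesPerDir 0) (D : TDomains d ℓ Mh k P' R) (hk : k ≤ m + K)

/-! ## §1  Blocks at small torus distance lie on adjacent levels -/

/-- **LEVEL WINDOW**: `d_T(s, t) < R·L·M_h − 1 ⇒ |j(s) − j(t)| ≤ 1` — the walk form (2.2) of the torus family (`levelGapT`: a chain of admissible bonds across a
level band has at least `R·L·M_h` bonds) through `B6Geometry.levelGap_dist_real`. [cite: Balaban1984PropagatorsII, (2.2) p.224, (2.60) p.234] -/
theorem level_window_of_dist_lt (hMh : 1 ≤ Mh) (hP : ∀ μ, 1 ≤ P' μ) (s t : ↥(bset D.toDomains))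
    (h : ((bondT D).dist s t : ℝ) < ((R * ((ℓ + 1) * Mh) - 1 : ℕ) : ℝ)) : t.1.1 ≤ s.1.1 + 1 ∧ s.1.1 ≤ t.1.1 + 1 := by
  have hd := levelGap_dist_real (connectedT (D := D) hMh hP) (levelGapT D) s t
  by_contra hne
  have h2 : (2 : ℝ) ≤ |(s.1.1 : ℝ) - t.1.1| := by
    rw [not_and_or] at hne
    rcases hne with h1 | h1
    · rw [not_le] at h1
      have : (s.1.1 : ℝ) + 1 < t.1.1 := by exact_mod_cast h1
      rw [abs_sub_comm, abs_of_pos (by linarith)]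
      have : (s.1.1 : ℝ) + 2 ≤ t.1.1 := by exact_mod_cast (by omega : s.1.1 + 2 ≤ t.1.1)
      linarith
    · rw [not_le] at h1
      have : (t.1.1 : ℝ) + 2 ≤ s.1.1 := by exact_mod_cast (by omega : t.1.1 + 2 ≤ s.1.1)
      rw [abs_of_pos (by linarith)]
      linarith
  have hmax : (1 : ℝ) ≤ max (|(s.1.1 : ℝ) - t.1.1| - 1) 0 := le_max_of_le_left (by linarith)
  have hN0 : (0 : ℝ) ≤ ((R * ((ℓ + 1) * Mh) - 1 : ℕ) : ℝ) := Nat.cast_nonneg _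
  have : ((R * ((ℓ + 1) * Mh) - 1 : ℕ) : ℝ) ≤ ((bondT D).dist s t : ℝ) :=
    le_trans (by nlinarith) hd
  linarith

/-- the level of a fine site is the level of its block. [cite: Balaban1984PropagatorsII, (2.3)–(2.4) p.224, dictionary] -/
theorem lev_toBox_eq (x : Site (PV d ℓ m K hd hL) 0) :
    D.lev (toBox hN x : Fin (d + 1) → ℤ) = (blkOf D.toDomains (toBox hN x)).1.1 :=
  lev_eq_of_blkOf_eq (D := D.toDomains) rfl

/-- blocks within `d_T < R·L·M_h − 1` of a block of level `j` have level `≥ n` whenever `n + 1 ≤ j` or `n = 1`. [cite: Balaban1984PropagatorsII, (2.2) p.224, (2.60) p.234] -/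
theorem level_ge_of_dist_lt (hMh : 1 ≤ Mh) (hP : ∀ μ, 1 ≤ P' μ) {n : ℕ} (y : ↥(bset D.toDomains)) (hny : n + 1 ≤ y.1.1 ∨ n = 1)
    (s : ↥(bset D.toDomains)) (hs : ((bondT D).dist s y : ℝ) < ((R * ((ℓ + 1) * Mh) - 1 : ℕ) : ℝ)) : n ≤ s.1.1 := by
  have hw := level_window_of_dist_lt D hMh hP s y hs
  have h1 := (scale_bounds D.toDomains s).1
  rcases hny with h | h <;> omega

/-! ## §2  Straight runs anchored at one end -/

include hk in
/-- **A RUN ANCHORED AT ITS START**: if `d_T(blk a, y) ≤ B`, `T ≤ a₀·L^n` and `B + a₀ + 4 < R·L·M_h − 1`, `1 ≤ n ≤ j(y) − 1 ∨ n = 1`, then every site of the run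
`a, a + e_μ, …, a + Te_μ` has level `≥ n` and `d_T(blk a, blk(a + Te_μ)) ≤ a₀ + 2`. [cite: Balaban1984PropagatorsII, (2.2) p.224, (2.46) p.231] -/
theorem run_of_start (hMh : 1 ≤ Mh) (hP : ∀ μ, 1 ≤ P' μ) {n : ℕ} (hn1 : 1 ≤ n) (hn : n ≤ m + K)
    (y : ↥(bset D.toDomains)) (hny : n + 1 ≤ y.1.1 ∨ n = 1) {B a₀ : ℕ} (hRM : B + a₀ + 4 < R * ((ℓ + 1) * Mh) - 1)
    (a : Site (PV d ℓ m K hd hL) 0) (μ : Fin (d + 1)) (ha : (bondT D).dist (blkOf D.toDomains (toBox hN a)) y ≤ B) :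
    ∀ T : ℕ, T ≤ a₀ * (ℓ + 1) ^ n →
      (∀ t ≤ T, n ≤ D.lev (toBox hN (runSite a μ t) : Fin (d + 1) → ℤ)) ∧
        (bondT D).dist (blkOf D.toDomains (toBox hN a)) (blkOf D.toDomains (toBox hN (runSite a μ T))) ≤ a₀ + 2 := by
  have hlev := level_ge_of_dist_lt D hMh hP y hny
  intro T
  induction T with
  | zero =>
    intro _
    refine ⟨fun t ht => ?_, by simp⟩
    have : t = 0 := by omega
    subst this
    rw [runSite_zero, lev_toBox_eq]
    exact hlev _ (by exact_mod_cast (lt_of_le_of_lt ha (by omega)))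
  | succ T ih =>
    intro hT
    obtain ⟨hl, hdist⟩ := ih (by omega)
    -- the new site is within one block of the previous one
    have h1 := distT_shift_le_one hN D (runSite a μ T) μ
    rw [← runSite_succ] at h1
    have hconn := connectedT (D := D) hMh hP
    have hnew : (bondT D).dist (blkOf D.toDomains (toBox hN (runSite a μ (T + 1)))) y ≤ B + a₀ + 3 := by
      have t1 := hconn.dist_triangle (u := blkOf D.toDomains (toBox hN (runSite a μ (T + 1))))
        (v := blkOf D.toDomains (toBox hN (runSite a μ T))) (w := y)
      have t2 := hconn.dist_triangle (u := blkOf D.toDomains (toBox hN (runSite a μ T)))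
        (v := blkOf D.toDomains (toBox hN a)) (w := y)
      rw [SimpleGraph.dist_comm] at h1
      rw [SimpleGraph.dist_comm] at hdist
      omega
    have hlT1 : n ≤ D.lev (toBox hN (runSite a μ (T + 1)) : Fin (d + 1) → ℤ) := by
      rw [lev_toBox_eq]
      exact hlev _ (by exact_mod_cast (lt_of_le_of_lt hnew (by omega)))
    have hl' : ∀ t ≤ T + 1, n ≤ D.lev (toBox hN (runSite a μ t) : Fin (d + 1) → ℤ) := by
      intro t ht
      rcases Nat.lt_or_ge t (T + 1) with h | h
      · exact hl t (by omega)
      · have : t = T + 1 := by omega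
        subst this; exact hlT1
    refine ⟨hl', ?_⟩
    refine (distT_run_le hN D hk hMh hP hn1 hn a μ (T + 1) hl').trans ?_
    refine (crossings_le hn a μ (T + 1)).trans ?_
    have : (T + 1) / (ℓ + 1) ^ n ≤ a₀ := by
      apply Nat.div_le_of_le_mul; rw [mul_comm]; omega
    omega

include hk in
/-- **A RUN ANCHORED AT ITS END**: the same conclusion when the FINAL site `a + Te_μ` (rather than `a`) lies in a block within `d_T ≤ B` of `y` (induction peeling
off the first step). [cite: Balaban1984PropagatorsII, (2.2) p.224, (2.46) p.231] -/
theorem run_of_end (hMh : 1 ≤ Mh) (hP : ∀ μ, 1 ≤ P' μ) {n : ℕ} (hn1 : 1 ≤ n) (hn : n ≤ m + K)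
    (y : ↥(bset D.toDomains)) (hny : n + 1 ≤ y.1.1 ∨ n = 1) {B a₀ : ℕ} (hRM : B + a₀ + 4 < R * ((ℓ + 1) * Mh) - 1) (μ : Fin (d + 1)) :
    ∀ (T : ℕ) (a : Site (PV d ℓ m K hd hL) 0), T ≤ a₀ * (ℓ + 1) ^ n →
      (bondT D).dist (blkOf D.toDomains (toBox hN (runSite a μ T))) y ≤ B →
      (∀ t ≤ T, n ≤ D.lev (toBox hN (runSite a μ t) : Fin (d + 1) → ℤ)) ∧
        (bondT D).dist (blkOf D.toDomains (toBox hN a)) (blkOf D.toDomains (toBox hN (runSite a μ T))) ≤ a₀ + 2 := by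
  have hlev := level_ge_of_dist_lt D hMh hP y hny
  intro T
  induction T with
  | zero =>
    intro a _ ha
    refine ⟨fun t ht => ?_, by simp⟩
    have : t = 0 := by omega
    subst this
    rw [runSite_zero] at ha ⊢
    rw [lev_toBox_eq]
    exact hlev _ (by exact_mod_cast (lt_of_le_of_lt ha (by omega)))
  | succ T ih =>
    intro a hT hb
    -- the run from `a + e_μ` of length `T` ends at the same site
    have hshift : ∀ t, runSite (runSite a μ 1) μ t = runSite a μ (t + 1) := fun t => by rw [runSite_add, add_comm]
    have hb' : (bondT D).dist (blkOf D.toDomains (toBox hN (runSite (runSite a μ 1) μ T))) y ≤ B := by rw [hshift]; exact hb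
    obtain ⟨hl, hdist⟩ := ih (runSite a μ 1) (by omega) hb'
    -- the first site is within one block of the second
    have h1 := distT_shift_le_one hN D a μ
    have hs1 : a.shift μ = runSite a μ 1 := by rw [← runSite_zero a μ, ← runSite_succ, runSite_zero]
    rw [hs1] at h1
    have hconn := connectedT (D := D) hMh hP
    have hnew : (bondT D).dist (blkOf D.toDomains (toBox hN a)) y ≤ B + a₀ + 3 := by
      have t1 := hconn.dist_triangle (u := blkOf D.toDomains (toBox hN a)) (v := blkOf D.toDomains (toBox hN (runSite a μ 1))) (w := y)
      have t2 := hconn.dist_triangle (u := blkOf D.toDomains (toBox hN (runSite a μ 1)))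
        (v := blkOf D.toDomains (toBox hN (runSite (runSite a μ 1) μ T))) (w := y)
      omega
    have hl0 : n ≤ D.lev (toBox hN a : Fin (d + 1) → ℤ) := by
      rw [lev_toBox_eq]
      exact hlev _ (by exact_mod_cast (lt_of_le_of_lt hnew (by omega)))
    have hl' : ∀ t ≤ T + 1, n ≤ D.lev (toBox hN (runSite a μ t) : Fin (d + 1) → ℤ) := by
      intro t ht
      rcases Nat.eq_zero_or_pos t with h | h
      · subst h; rw [runSite_zero]; exact hl0
      · obtain ⟨t', rfl⟩ : ∃ t', t = t' + 1 := ⟨t - 1, by omega⟩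
        rw [← hshift]; exact hl t' (by omega)
    refine ⟨hl', ?_⟩
    refine (distT_run_le hN D hk hMh hP hn1 hn a μ (T + 1) hl').trans ?_
    refine (crossings_le hn a μ (T + 1)).trans ?_
    have : (T + 1) / (ℓ + 1) ^ n ≤ a₀ := by
      apply Nat.div_le_of_le_mul; rw [mul_comm]; omega
    omega


end

end Literature.MathematicalPhysics.QuantumFieldTheory.Balaban1983to89.B6BlockRunsKLevelV1
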